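import Mathlib
import HarnessLib
import HarnessLib.Audit
import Summits.CriticalPhenomena.Statement
import Literature.Probability.Percolation.CardyFormula
import HarnessLib.Audit.Status.Attr

/-!
Route: CardyMonotoneApproach

DORMANT since 2026-08-24T22:56:56Z (reconciler: no traction for 7.1 d (last activity item-evidence-added at 2026-08-17T18:54:11Z); parked, not closed — `ledger route dormant route-CriticalPhenomena-CardyMonotoneApproach --off` to reacti) — unstaffed, not closed; items shared with open routes are served there. `ledger route dormant <id> --off` reactivates.

# Route CardyMonotoneApproach — Cardy on rectangles from a sign: eventual monotonicity in n of
P(LR([0,pn+1]x[0,qn])) gives existence, Kleban-Zagier-type engines the value, transport the rest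

It suffices to show X = RectCardy: Cardy's formula for bond-ℤ² at p = 1/2 in every AXIS-PARALLEL
RECTANGLE (Ω = (0,w)×(0,h), marks at
the corners ih, 0, w, w+ih, crossing from the left side (arc 0) to the right side (arc 2)):
bondDomainCrossingProb R δ → F(η) as δ → 0⁺.
The route realises card monotone-approach-lyapunov: X = (existence of the rectangle limit) ∧ (its
value), and the EXISTENCE half is to come
from a SIGN — crux MonotoneApproach (Conjecture M, stated on the parity-free, duality-closed lattice
family): for all p, q ≥ 1 the exact
box-crossing probabilities n ↦ P_½(LR([0,pn+1]×[0,qn])) = crossingProb half (p*n+1) (q*n) are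
eventually monotone. Given M, the limits
Π(p/q) exist, are monotone in p/q and satisfy Π(r)+Π(1/r) = 1 exactly (tree duality
crossingProb_add_crossingProb_symm_holds); a soft
sandwich (support RectGlue) turns this plus the value crux RectValue (any limit of a rectangle's
crossing probability is F(η); engines:
KlebanZagier2003 Thm 1, whose duality hypothesis (ii) is exact here, fed by transfer-matrix tower
structure) into X with NO arm estimates.
X → CardyFormulaZ2 by conformal transport (crux ConfInvTransport = stmt-CriticalPhenomena-0794 of
CardyHarmonicInvariants, shared) and
the analytic support RectRealises / RectModulus (every cross-ratio is that of some rectangle).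
Lean: `∀ (R : Literature.Probability.RandomPlanarGeometry.ConformalRectangle) (w h : ℝ), 0 < w → 0 <
h → R.carrier = Set.Ioo (0:ℝ) w ×ℂ Set.Ioo (0:ℝ) h → (R.pt 0 = (h:ℂ) * Complex.I ∧ R.pt 1 = 0 ∧ R.pt
2 = (w:ℂ) ∧ R.pt 3 = (w:ℂ) + (h:ℂ) * Complex.I) → R.HasCrossingLimit
(Literature.Probability.Percolation.bondDomainCrossingProb R)
Literature.Probability.RandomPlanarGeometry.cardyFunction`

## Assembly
Pure logic (sorry-free in the planner's Sketch.lean, theorem assembly_proof): given R', φ', x'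
uniformizing, η' = crossRatio x' ∈ (0,1)
(ConformalRectangle.crossRatio_mem_Ioo_of_isUniformizing); RectRealises gives a rectangle R with
datum (φ, x), crossRatio x = η'; RectCardy
gives bondDomainCrossingProb R → F(crossRatio x); ConfInvTransport moves the limit to R'; rewrite
crossRatio x = crossRatio x'. The cruxes
MonotoneApproach and RectValue enter X = RectCardy through the support RectGlue (RectModulus →
MonotoneApproach → RectValue → RectCardy).

Rationale: WHY THIS LINE. Every route on this conjunct needs LimitExists (CardyUniqueLimit r3, CardyRotToConf
r3) and none has a mechanism for it; the oldest device
for existence of a limit is a sign (monotone/subadditive sequences: Fekete, Hammersley–Welsh), never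
tried on critical crossing probabilities,
whose finite-size corrections on bond-ℤ² are tiny and, where tabulated, one-signed (Ziff1992;
LanglandsPouliotSaintaubin1994 = arXiv:math/9401222
§3; HoviAharony1996; Ziff1996 effective aspect ratio r+c/L; Ziff2011 correction exponents). In the
Schramm–Smirnov picture the mesh family is
one orbit of the dilation flow and a functional monotone along the orbit is a Lyapunov function
collapsing its ω-limit set to a point; here the
functionals are the crossing probabilities themselves. Imported: dynamical-systems framing
(Lyapunov/ω-limit), exact lattice duality, and
number-theoretic rigidity of the value (KlebanZagier2003: an even conformal block with Π(1/r) =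
1−Π(r) is Cardy's function) — so the line
splits the conjunct into existence-by-sign (new, falsifiable by exact rational computation: one
oscillation in n ↦ crossingProb half (2n+1) n
kills strong M), value-given-existence (shared with the TL/Razumov–Stroganov value engines of card
tl-spectral-kleban-zagier) and transport
(shared with CardyHarmonicInvariants). Design note: the card's family crossingProb ½ (⌊rn⌋+1) n is
NOT eventually monotone for non-integer r
for a trivial reason (the {rn} wobble is O(1/n), the order of the trend), so M is filed on (pn+1,
qn), closed under duality (p,q)↔(q,p),
with p = q giving exactly 1/2 (crossingProb_half_succ_self_holds). Negatives index (stmt-0772, SAW)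
is unrelated.

RANKED CRUXES. #0 RectCardy (target) — Cardy's formula for bond-ℤ² crossing probabilities of every
axis-parallel rectangle (0,w)×(0,h) with corner marks ih, 0, w, w+ih (left-to-right crossing):
R.HasCrossingLimit (bondDomainCrossingProb R) cardyFunction. X of the thesis; = existence (from
MonotoneApproach via RectGlue) + value (RectValue). (why it might fail: It is Cardy's formula
restricted to rectangles (Cardy1992; LPS94 numerics agree to ~5e-3): fails if the ℤ² rectangle
limits do not exist or are not the conformal-modulus function F∘η (Zhang arXiv:2206.04599 Cor. 2
claims non-Cardy on ℤ², unrefereed).) [Cardy1992, LanglandsPouliotSaintaubin1994,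
arXiv:math/9401222, BollobasRiordan2006, Schramm2007ICM, arXiv:2206.04599]
#2 MonotoneApproach (crux) — Conjecture M (card monotone-approach-lyapunov M1/M2, parity-free form):
for all integers p, q ≥ 1 the sequence n ↦ crossingProb half (p*n+1) (q*n) =
P_½(LR([0,pn+1]×[0,qn])) is eventually monotone (non-decreasing or non-increasing from some N(p,q)
on). p = q is identically 1/2; (p,q) and (q,p) are exchanged by exact duality; (kp,kq) is a
subsequence of (p,q). Weak (eventual) form only; direction not asserted. [difficulty: open-problem]
(why it might fail: Needs one dominant one-signed finite-size correction per p/q (Ziff1996 r+c/L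
shift, Ziff2011 exponents): a vanishing leading amplitude with competing subleading terms,
log-periodic corrections or sign-alternating transfer-matrix modes at gap O(1/n) oscillate forever;
no cross-size coupling is known.) [Ziff1992, Ziff1996, HoviAharony1996, Ziff2011,
LanglandsPouliotSaintaubin1994, arXiv:math/9401222, GrimmettPercolation1999,
lean:Literature.Probability.Percolation.crossingProb_add_crossingProb_symm_holds,
lean:Literature.Probability.Percolation.crossingProb_half_succ_self_holds]
#3 RectValue (crux) — Value given existence, rectangles only: for an axis-parallel rectangle R as
above and any uniformizing datum (φ, x), if bondDomainCrossingProb R δ → L as δ → 0⁺ then L =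
cardyFunction (crossRatio x). Engines: KlebanZagier2003 Thm 1 (Π an even conformal block of
dimension α > 0 with Π(1/r) = 1 − Π(r) ⇒ α = 1/3 and Π = Cardy; (ii) is exact for the lattice limits
of MonotoneApproach), fed by the Temperley–Lieb / transfer-matrix tower structure (card
tl-spectral-kleban-zagier); or any rigidity argument run on rectangles. [difficulty: open-problem]
(why it might fail: It is the value half of Cardy on ℤ²: KlebanZagier2003 Thm 1 needs Π to be an
even conformal block (tower structure unproved for the ℤ² transfer matrix); SLE₆/CardyRigidity
arguments need limits in ALL domains, not rectangles; embedding-blind proofs are barred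
(Beffara2008Universal Prop. 4).) [KlebanZagier2003, Cardy1992, LanglandsPouliotSaintaubin1994,
Beffara2008Universal, arXiv:0708.3908,
lean:Literature.Barriers.CriticalPhenomena.EmbeddingModulusUniqueness, paper:arxiv-math-ph_0209023
p.6 (Theorem 1)]
#4 ConfInvTransport (crux) — Conformal invariance of ℤ² crossing limits in transport form (=
stmt-CriticalPhenomena-0794 of route CardyHarmonicInvariants, verbatim, so the item is shared): two
conformal rectangles with uniformizing data of equal cross-ratio have the same limiting crossing
probability whenever one of them has a limit. [difficulty: open-problem] (why it might fail: It is
conformal invariance of the ℤ² crossing limit (Schramm2007ICM Problem 2.11) in transport form: false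
if ℤ² limits are only similarity-invariant; no embedding-blind proof exists (Beffara2008Universal
Prop. 4); needs an observable or a DKKMO-type symmetry upgrade.) [Smirnov2001, Schramm2007ICM,
Beffara2008Universal, arXiv:0708.3908, DKKMO2020Rotational, arXiv:2012.11672,
lean:Literature.Barriers.CriticalPhenomena.EmbeddingModulusUniqueness]
#9 RectGlue (support) — Glue (card M4, soft form): RectModulus → MonotoneApproach → RectValue →
RectCardy. Proof plan (no arm estimates): (i) M ⇒ a(p,q,n) → Π(p/q), consistent under (p,q) ↦
(kp,kq), Π non-increasing on ℚ₊ (crossingProb antitone in m, monotone in n), Π(r)+Π(1/r) = 1; (ii)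
for R = (0,w)×(0,h) at mesh δ, Ω∩δℤ² is a box, Ω_δ = the box, discrete arcs = extreme columns up to
the two top corner vertices, so crossingProb ½ M_δ (N_δ−1) ≤ bondDomainCrossingProb R δ ≤
crossingProb ½ M_δ N_δ after translation, M_δ/N_δ → w/h; (iii) sandwich: limsup ≤ Π(r₁) for rational
r₁ < r, liminf ≥ Π(r₂) for rational r₂ > r, so the full-filter limit exists off the countable jump
set J of Π; (iv) RectValue + rectangles of every aspect (RectModulus, exists_isUniformizing_holds)
give limit = F(g(r)) for r ∉ J; F∘g continuous (continuousOn_cardyFunction_Ioo, RectModulus) and Π±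
monotone agreeing with F∘g on a dense set force J = ∅ and limit = F(g(w/h)) = F(crossRatio x)
everywhere. [difficulty: L] [GrimmettPercolation1999, BollobasRiordan2006, SchrammSmirnov2011,
arXiv:1101.5820, lean:Literature.Probability.Percolation.crossingProb,
lean:Literature.Probability.LatticeModels.discreteArc,
lean:Literature.Probability.RandomPlanarGeometry.continuousOn_cardyFunction_Ioo,
lean:Literature.Probability.RandomPlanarGeometry.MarkedDomain.exists_isUniformizing_holds]
#9 RectModulus (support) — Rectangles are conformal rectangles and their modulus is a continuous
function of the aspect ratio onto (0,1): (a) for all w, h > 0 some R : ConformalRectangle has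
carrier (0,w)×(0,h) and corner marks ih, 0, w, w+ih (polygonDomain of PolygonalDomains.lean); (b)
there is g : ℝ → ℝ, continuous on (0,∞) with g''(0,∞) = (0,1), such that every uniformizing datum
(φ, x) of every such R has crossRatio x = g(w/h) (classically g via the elliptic modulus:
Schwarz–Christoffel for the rectangle, Ahlfors Ch. 6; datum-independence is
crossRatio_eq_of_isUniformizing_holds). Pure complex analysis. [difficulty: L] [Ahlfors1979,
LanglandsPouliotSaintaubin1994, arXiv:math/9401222,
lean:Literature.Probability.RandomPlanarGeometry.polygonDomain,
lean:Literature.Probability.RandomPlanarGeometry.ConformalRectangle.crossRatio_eq_of_isUniformizing_holds]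
#9 RectRealises (support) — Every η ∈ (0,1) is the cross-ratio of a uniformizing datum of some
axis-parallel rectangle with corner marks (w, h > 0). Immediate from RectModulus and
MarkedDomain.exists_isUniformizing_holds (proved in the planner sketch:
rectRealises_of_rectModulus); it is the hypothesis the Assembly consumes. [difficulty: provable-now]
[Ahlfors1979,
lean:Literature.Probability.RandomPlanarGeometry.MarkedDomain.exists_isUniformizing_holds]

TWO-LAYER PLAN. Foreseen glued splits (nothing filed now): MonotoneApproach ⇐ StrongMIntegerAspect
(p | q or q | p, all n, by an explicit measure-transporting
injection or TL/SUSY positivity, card M2/M3) → EventualMGeneral → MonotoneApproach; RectValue ⇐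
TowerStructure (Π from M is an even
conformal block of positive dimension: transfer-matrix spectrum of the (pn+2)-column strip organises
into integer-spaced towers) →
KlebanZagierUniqueness (KlebanZagier2003 Thm 1 as a Literature fact applied to Π) → RectValue;
RectGlue ⇐ RectDiscretisation (box/arc
bookkeeping (ii)) → SoftSandwich ((i),(iii),(iv)) → RectGlue.

KILL CRITERIA. ¬MonotoneApproach for one (p,q) — e.g. a certified exact-rational oscillation of n ↦
crossingProb half (2n+1) n persisting beyond any N, or
a proof of a log-periodic correction — closes the route (`close --reason refuted:MonotoneApproach`);
the data then feeds card
logperiodic-limitexists-hunt. ¬RectValue with limits existing = a non-Cardy ℤ² rectangle limit: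
refutes the conjunct itself (report).
¬ConfInvTransport for one pair = no conformal invariance on ℤ²: refutes the conjunct. LimitExists
(CardyUniqueLimit r3) or X_U proved
elsewhere moots MonotoneApproach's role (route then superseded by
CardyUniqueLimit/CardyHarmonicInvariants); RectCardy proved by an
observable moots M and RectValue but keeps the Assembly.

NOT DECOMPOSED YET. The proof avenue for M (injection A_n × {0,1}^ΔE ↪ A_{n+1} along the lowest
crossing, vs. Hagendorf–Liénardy supercharge positivity,
arXiv:1612.02951) — layer-2 children once refuters have run the exact layer; the direction of
monotonicity and N(p,q); the strong
(all-n) form; the tower-structure input of RectValue (belongs to the value-engine cards);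
quantitative rates; rotated rectangles (DKKMO,
not needed: ConfInvTransport covers all conformal rectangles); Osgood-boundary hygiene of the
discretisation (irrelevant for rectangles).

CHEAPEST FALSIFIER. Exact rational layer: compute crossingProb half (2n+1) n (p=2, q=1) for n = 1…7
by a boundary-connectivity transfer matrix (states ~
Catalan numbers of the (n+1)-row column; minutes to an hour of kit compute) and crossingProb half
(3n+1) (2n) for n ≤ 4; one change of
direction beyond n = 2 that recurs kills the strong form and makes the weak form suspect; then
Monte-Carlo signs of a(p,q,2n) − a(p,q,n),
n = 16…512 (10⁹ samples, duality control variate: a(p,q,n)+a(q,p,n) = 1 exactly). Not run here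
(compute-free hub, planner seat): it is the
refuters' first job and is shared with card logperiodic-limitexists-hunt.

NUMBERS. Cardy values to approach (computed here from F and the rectangle modulus η(r) =
((1−k)/(1+k))², r = 2K(k)/K′(k)): Π(1) = 1/2 at η = 1/2
(exact on the lattice: crossingProb half (n+1) n = 1/2); Π(3/2) ≈ 0.29649 (η ≈ 0.13389); Π(2) ≈
0.17565 (η ≈ 0.029437) = 1 − Π(1/2);
Π(3) ≈ 0.06164 (η ≈ 0.0012904) (Cardy1992; the card's quoted 0.17677 for r = 2 is not this
convention's value); LPS94 ℤ²-bond numerics match Cardy to ~5·10⁻³ at L = 200 (arXiv:math/9401222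
§3.2);
finite-size corrections for free-boundary bond-ℤ² crossing: leading r_eff = r + c/L shift
(Ziff1996), correction-to-scaling exponents
(Ziff2011). KlebanZagier2003 Thm 1: α is forced to 1/3. Items at open: 8 (1 target, 3 cruxes, 3
support, 1 assembly).

DEFINITION REQUESTS. None: crossingProb, half, bondDomainCrossingProb, ConformalRectangle
(carrier/pt/arc), IsUniformizing, crossRatio, HasCrossingLimit,
cardyFunction, reProdIm (×ℂ) all exist; rectangles as Jordan domains come from
Literature.Probability.RandomPlanarGeometry.polygonDomain.
Fact wanted later (cite item, not filed now): KlebanZagier2003 Thm 1 as a Literature named fact over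
an `IsEvenConformalBlock` notion.

Novelty: Searches (2026-08-15): `lit search --hybrid "finite-size corrections crossing probability square
lattice bond percolation rectangle aspect
ratio"` (15 book hits: Kesten1982, BollobasRiordan2006 p.157ff, Grimmett1999/2018 — RSW and Cardy
statements, no monotonicity-in-size);
`lit search --source crossref` ×6 ("Spanning probability in 2D percolation Ziff" →
doi:10.1103/physrevlett.69.2670, 10.1103/physrevlett.72.1941,
10.1088/0305-4470/28/5/013; "effective extrapolation length" → 10.1103/physreve.54.2547; "Crossing
probabilities and modular forms" →
10.1023/a:1026012600583, 10.1016/s0378-4371(00)00035-2, 10.4310/cntp.2009.v3.n4.a4; "Hovi Aharony" →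
10.1103/physreve.53.235;
"correction-to-scaling Ziff" → 10.1103/physreve.83.020107; "monotonicity crossing probability
lattice size coupling" → only threshold /
first-passage monotonicity: 10.1214/19-aop1355, 10.1214/15-aop1052); `lit search --source zbmath
"crossing probability finite-size
corrections percolation Ziff"` (1: arXiv:0811.3080); arxiv/openalex/s2 APIs rate-limited (429); `lit
galaxy search --star all` ×4
("monotonic in the system size crossing probability percolation", "finite-size corrections to
Cardy's formula square lattice",
"extrapolation length crossing probability", "crossing probabilities and modular forms": 0 hits /
service saturated); `lit frontier
CriticalPhenomena --since 2020` (30 rows, none on finite-size monotonicity or existence of ℤ²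
crossing limits); `lit bridges
CriticalPhenomena --cross any`; `lit re  [refs: 10.1103/physrevlett.69.2670, 10.1103/physrevlett.72.1941, 10.1088/0305-4470/28/5/013, 10.1103/physreve.54.2547, 10.1023/a:1026012600583, 10.1016/s0378-4371(00, 10.4310/cntp.2009.v3.n4.a4, 10.1103/physreve.53.235, 10.1103/physreve.83.020107, 10.1214/19-aop1355, 10.1214/15-aop1052, 10.1103/physreve.54.2547:, 0811.3080, math-ph/0209023, 1612.02951, 2603.06268, math/9401222, doi:10.1103/physrevlett.69]

Barriers (technique_class: monotonicity lyapunov finite-size transfer-matrix): - technique_class: monotonicity lyapunov finite-size transfer-matrix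
- Literature.Barriers.CriticalPhenomena.EmbeddingModulusUniqueness: MonotoneApproach, RectGlue,
RectModulus, RectRealises are existence/analysis statements, which the barrier's `blocks` field
exempts explicitly ("NOT blocked: existence-only statements such as CardyUniqueLimit.LimitExists");
indeed M is shear-covariant in form and claims no symmetry of the limit. RectValue, RectCardy and
ConfInvTransport ARE in the blocked class for embedding-blind arguments (the barrier even lists
"strict monotonicity of crossing probabilities of Euclidean rectangles in ρ" and RSW among shared
inputs): the route does not evade it there; the bet is that the value enters through
embedding-specific inputs — the ℤ² transfer matrix at its Temperley–Lieb point (tower structure) and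
the EXACT Euclidean duality Π(r)+Π(1/r)=1 of the square embedding feeding KlebanZagier2003 Thm 1 —
and that ConfInvTransport is carried by the observable/symmetry-upgrade routes that already want
stmt-0794 (evasions (i)/(ii) of the barrier: exact π/2 symmetry + dkkmo_rotation_invariance, or an
integrable observable).
- Literature.Barriers.CriticalPhenomena.SmirnovTriangularOnly: does not apply — no colour switching,
no harmonic triple, no discrete contour integrals anywhere in the line.
- Literature.Barriers.CriticalPhenomena.CoveringLatticeShift: does not apply — no model
interpolation / Russo derivative in q; the only exact identity used is planar dua

History (route lifecycle, newest last):
- 2026-08-24T22:56:56Z · DORMANT — reconciler: no traction for 7.1 d (last activity item-evidence-added at 2026-08-17T18:54:11Z); parked, not closed — `ledger route dormant route-CriticalPhenomen (operator:999:2436218)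

sub-problem: CardyFormulaZ2 · status: dormant · opened planner-plancard-CriticalPhenomena-CardyFormu-cf1e0b77-0 2026-08-15T11:43:05Z · rev 4 · ledger route-CriticalPhenomena-CardyMonotoneApproach
GENERATED by the gate from the ledger (D-0016/17). Provers cite these decls: `theorem foo : Summit.CriticalPhenomena.CardyFormulaZ2.Theses.CardyMonotoneApproach.<Decl> := …` in Summits/CriticalPhenomena/CardyFormulaZ2/Theorems/<Name>.lean.
-/

namespace Summit.CriticalPhenomena.CardyFormulaZ2.Theses.CardyMonotoneApproach

open scoped BigOperators Topology Manifold Classical MeasureTheory ProbabilityTheory Matrix InnerProductSpace ComplexConjugate ContinuousMap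
open Filter Set Function TopologicalSpace MeasureTheory

attribute [summit_statement] _root_.CardyFormulaZ2

/-- item stmt-CriticalPhenomena-5843 · target · rank 0 · open · by planner
why it might fail: It is Cardy's formula restricted to rectangles (Cardy1992; LPS94 numerics agree to ~5e-3): fails if the ℤ² rectangle limits do not exist or are not the conformal-modulus function F∘η (Zhang arXiv:2206.04599 Cor. 2 claims non-Cardy on ℤ², unrefereed).
sources: Cardy1992, LanglandsPouliotSaintaubin1994, arXiv:math/9401222, BollobasRiordan2006, Schramm2007ICM, arXiv:2206.04599
[target] Cardy's formula for bond-ℤ² crossing probabilities of every axis-parallel rectangle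
(0,w)×(0,h) with corner marks ih, 0, w, w+ih (left-to-right crossing): R.HasCrossingLimit
(bondDomainCrossingProb R) cardyFunction. X of the thesis; = existence (from MonotoneApproach via
RectGlue) + value (RectValue). -/
@[route_item "route-CriticalPhenomena-CardyMonotoneApproach", crux]
def RectCardy : Prop :=
  ∀ (R : Literature.Probability.RandomPlanarGeometry.ConformalRectangle) (w h : ℝ), 0 < w → 0 < h → R.carrier = Set.Ioo (0:ℝ) w ×ℂ Set.Ioo (0:ℝ) h → (R.pt 0 = (h:ℂ) * Complex.I ∧ R.pt 1 = 0 ∧ R.pt 2 = (w:ℂ) ∧ R.pt 3 = (w:ℂ) + (h:ℂ) * Complex.I) → R.HasCrossingLimit (Literature.Probability.Percolation.bondDomainCrossingProb R) Literature.Probability.RandomPlanarGeometry.cardyFunction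

/-- item stmt-CriticalPhenomena-5844 · crux · rank 2 · open · by planner
why it might fail: Eventual monotonicity needs one dominant one-signed finite-size correction per (p,q) (Ziff1996 shift r→r+c/L); a vanishing leading amplitude, opposite-sign corrections with close exponents (Ziff2011) or complex (log-periodic) transfer-matrix modes give endless sign changes; no size coupling known.
sources: Ziff1996, Ziff2011, Ziff1992, HoviAharony1996, LanglandsPouliotSaintaubin1994, arXiv:math/9401222
[crux] Conjecture M (card monotone-approach-lyapunov M1/M2, parity-free form): for all integers p, q
≥ 1 the sequence n ↦ crossingProb half (p*n+1) (q*n) = P_½(LR([0,pn+1]×[0,qn])) is eventually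
monotone (non-decreasing or non-increasing from some N(p,q) on). p = q is identically 1/2; (p,q) and
(q,p) are exchanged by exact duality; (kp,kq) is a subsequence of (p,q). Weak (eventual) form only;
direction not asserted. [difficulty: open-problem] -/
@[route_item "route-CriticalPhenomena-CardyMonotoneApproach", crux]
def MonotoneApproach : Prop :=
  ∀ p q : ℕ, 1 ≤ p → 1 ≤ q → ∃ N : ℕ, (MonotoneOn (fun n : ℕ ↦ Literature.Probability.Percolation.crossingProb Literature.Probability.Percolation.half (p * n + 1) (q * n)) (Set.Ici N) ∨ AntitoneOn (fun n : ℕ ↦ Literature.Probability.Percolation.crossingProb Literature.Probability.Percolation.half (p * n + 1) (q * n)) (Set.Ici N))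

/-- item stmt-CriticalPhenomena-5845 · crux · rank 3 · open · by planner
why it might fail: Value half of Cardy on ℤ² (open, Schramm2007ICM Prob. 2.11): KlebanZagier2003 Thm 1 (p.6) needs Π to be an EVEN conformal block of dimension α>0, unproved for any ℤ² limit; SLE₆/rigidity needs all domains, not rectangles; Zhang arXiv:2206.04599 Cor. 2 even claims a non-Cardy ℤ² limit.
sources: KlebanZagier2003, paper:arxiv-math-ph_0209023 p.6 (Theorem 1), lean:Literature.Probability.RandomPlanarGeometry.KlebanZagier.theorem1, Cardy1992, Schramm2007ICM, LanglandsPouliotSaintaubin1994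
[crux] Value given existence, rectangles only: for an axis-parallel rectangle R as above and any
uniformizing datum (φ, x), if bondDomainCrossingProb R δ → L as δ → 0⁺ then L = cardyFunction
(crossRatio x). Engines: KlebanZagier2003 Thm 1 (Π an even conformal block of dimension α > 0 with
Π(1/r) = 1 − Π(r) ⇒ α = 1/3 and Π = Cardy; (ii) is exact for the lattice limits of
MonotoneApproach), fed by the Temperley–Lieb / transfer-matrix tower structure (card
tl-spectral-kleban-zagier); or any rigidity argument run on rectangles. [difficulty: open-problem] -/
@[route_item "route-CriticalPhenomena-CardyMonotoneApproach", crux]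
def RectValue : Prop :=
  ∀ (R : Literature.Probability.RandomPlanarGeometry.ConformalRectangle) (w h : ℝ), 0 < w → 0 < h → R.carrier = Set.Ioo (0:ℝ) w ×ℂ Set.Ioo (0:ℝ) h → (R.pt 0 = (h:ℂ) * Complex.I ∧ R.pt 1 = 0 ∧ R.pt 2 = (w:ℂ) ∧ R.pt 3 = (w:ℂ) + (h:ℂ) * Complex.I) → ∀ (φ : Literature.Probability.RandomPlanarGeometry.ConformalEquiv UpperHalfPlane.upperHalfPlaneSet R.carrier) (x : Fin 4 → ℝ), R.IsUniformizing φ x → ∀ L : ℝ, Filter.Tendsto (Literature.Probability.Percolation.bondDomainCrossingProb R) (nhdsWithin 0 (Set.Ioi 0)) (nhds L) → L = Literature.Probability.RandomPlanarGeometry.cardyFunction (Literature.Probability.RandomPlanarGeometry.crossRatio x)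

/-- item stmt-CriticalPhenomena-0794 · crux · rank 4 · open · by planner
why it might fail: It is conformal invariance of the ℤ² crossing limit (Schramm2007ICM Problem 2.11) in transport form: false if ℤ² limits are only similarity-invariant; no embedding-blind proof exists (Beffara2008Universal Prop. 4); needs an observable or a DKKMO-type symmetry upgrade.
sources: Smirnov2001, Schramm2007ICM, Beffara2008Universal, arXiv:0708.3908, DKKMO2020Rotational, arXiv:2012.11672
[crux] Conformal invariance of crossing limits on Z^2, transport form: two conformal rectangles with
uniformizing data of equal cross-ratio have the same limiting crossing probability whenever one of
them has a limit (Z^2 analogue of Literature tendsto_triDomainCrossingProb_of_crossRatio_eq).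
Consequence of X_H; open. -/
@[route_item "route-CriticalPhenomena-CardyMonotoneApproach", crux]
def ConfInvTransport : Prop :=
  ∀ (R R' : Literature.Probability.RandomPlanarGeometry.ConformalRectangle) (φ : Literature.Probability.RandomPlanarGeometry.ConformalEquiv UpperHalfPlane.upperHalfPlaneSet R.carrier) (x : Fin 4 → ℝ) (φ' : Literature.Probability.RandomPlanarGeometry.ConformalEquiv UpperHalfPlane.upperHalfPlaneSet R'.carrier) (x' : Fin 4 → ℝ), R.IsUniformizing φ x → R'.IsUniformizing φ' x' → Literature.Probability.RandomPlanarGeometry.crossRatio x = Literature.Probability.RandomPlanarGeometry.crossRatio x' → ∀ L : ℝ, Filter.Tendsto (Literature.Probability.Percolation.bondDomainCrossingProb R) (nhdsWithin 0 (Set.Ioi 0)) (nhds L) → Filter.Tendsto (Literature.Probability.Percolation.bondDomainCrossingProb R') (nhdsWithin 0 (Set.Ioi 0)) (nhds L)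

/-- item stmt-CriticalPhenomena-5846 · support · rank 9 · open · by planner
sources: GrimmettPercolation1999, BollobasRiordan2006, SchrammSmirnov2011, arXiv:1101.5820, lean:Literature.Probability.Percolation.crossingProb, lean:Literature.Probability.LatticeModels.discreteArc
[support] Glue (card M4, soft form): RectModulus → MonotoneApproach → RectValue → RectCardy. Proof
plan (no arm estimates): (i) M ⇒ a(p,q,n) → Π(p/q), consistent under (p,q) ↦ (kp,kq), Π
non-increasing on ℚ₊ (crossingProb antitone in m, monotone in n), Π(r)+Π(1/r) = 1; (ii) for R =
(0,w)×(0,h) at mesh δ, Ω∩δℤ² is a box, Ω_δ = the box, discrete arcs = extreme columns up to the two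
top corner vertices, so crossingProb ½ M_δ (N_δ−1) ≤ bondDomainCrossingProb R δ ≤ crossingProb ½ M_δ
N_δ after translation, M_δ/N_δ → w/h; (iii) sandwich: limsup ≤ Π(r₁) for rational r₁ < r, liminf ≥
Π(r₂) for rational r₂ > r, so the full-filter limit exists off the countable jump set J of Π; (iv)
RectValue + rectangles of every aspect (RectModulus, exists_isUniformizing_holds) give limit =
F(g(r)) for r ∉ J; F∘g continuous (continuousOn_cardyFunction_Ioo, RectModulus) and Π± monotone
agreeing with F∘g on a dense set force J = ∅ and limit = F(g(w/h)) = F(crossRatio x) everywhere.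
[difficulty: L] -/
@[route_item "route-CriticalPhenomena-CardyMonotoneApproach", crux]
def RectGlue : Prop :=
  ((∀ w h : ℝ, 0 < w → 0 < h → ∃ R : Literature.Probability.RandomPlanarGeometry.ConformalRectangle, R.carrier = Set.Ioo (0:ℝ) w ×ℂ Set.Ioo (0:ℝ) h ∧ (R.pt 0 = (h:ℂ) * Complex.I ∧ R.pt 1 = 0 ∧ R.pt 2 = (w:ℂ) ∧ R.pt 3 = (w:ℂ) + (h:ℂ) * Complex.I)) ∧ ∃ g : ℝ → ℝ, ContinuousOn g (Set.Ioi 0) ∧ g '' Set.Ioi 0 = Set.Ioo 0 1 ∧ ∀ (R : Literature.Probability.RandomPlanarGeometry.ConformalRectangle) (w h : ℝ), 0 < w → 0 < h → R.carrier = Set.Ioo (0:ℝ) w ×ℂ Set.Ioo (0:ℝ) h → (R.pt 0 = (h:ℂ) * Complex.I ∧ R.pt 1 = 0 ∧ R.pt 2 = (w:ℂ) ∧ R.pt 3 = (w:ℂ) + (h:ℂ) * Complex.I) → ∀ (φ : Literature.Probability.RandomPlanarGeometry.ConformalEquiv UpperHalfPlane.upperHalfPlaneSet R.carrier) (x : Fin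 4 → ℝ), R.IsUniformizing φ x → Literature.Probability.RandomPlanarGeometry.crossRatio x = g (w / h)) → (∀ p q : ℕ, 1 ≤ p → 1 ≤ q → ∃ N : ℕ, (MonotoneOn (fun n : ℕ ↦ Literature.Probability.Percolation.crossingProb Literature.Probability.Percolation.half (p * n + 1) (q * n)) (Set.Ici N) ∨ AntitoneOn (fun n : ℕ ↦ Literature.Probability.Percolation.crossingProb Literature.Probability.Percolation.half (p * n + 1) (q * n)) (Set.Ici N))) → (∀ (R : Literature.Probability.RandomPlanarGeometry.ConformalRectangle) (w h : ℝ), 0 < w → 0 < h → R.carrier = Set.Ioo (0:ℝ) w ×ℂ Set.Ioo (0:ℝ) h → (R.pt 0 = (h:ℂ) * Complex.I ∧ R.pt 1 = 0 ∧ R.pt 2 = (w:ℂ) ∧ R.pt 3 = (w:ℂ) + (h:ℂ) * Complex.I) → ∀ (φ : Literature.Probability.RandomPlanarGeometry.ConformalEquiv UpperHalfPlane.upperHalfPlaneSet R.carrier) (x : Fin 4 → ℝ), R.IsUniformizing φ x → ∀ L : ℝ, Filter.Tendsto (Literature.Probability.Percolation.bondDomainCrossingProb R) (nhdsWithin 0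 (Set.Ioi 0)) (nhds L) → L = Literature.Probability.RandomPlanarGeometry.cardyFunction (Literature.Probability.RandomPlanarGeometry.crossRatio x)) → (∀ (R : Literature.Probability.RandomPlanarGeometry.ConformalRectangle) (w h : ℝ), 0 < w → 0 < h → R.carrier = Set.Ioo (0:ℝ) w ×ℂ Set.Ioo (0:ℝ) h → (R.pt 0 = (h:ℂ) * Complex.I ∧ R.pt 1 = 0 ∧ R.pt 2 = (w:ℂ) ∧ R.pt 3 = (w:ℂ) + (h:ℂ) * Complex.I) → R.HasCrossingLimit (Literature.Probability.Percolation.bondDomainCrossingProb R) Literature.Probability.RandomPlanarGeometry.cardyFunction)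

/-- item stmt-CriticalPhenomena-5847 · support · rank 9 · open · by planner
sources: Ahlfors1979, LanglandsPouliotSaintaubin1994, arXiv:math/9401222, lean:Literature.Probability.RandomPlanarGeometry.polygonDomain, lean:Literature.Probability.RandomPlanarGeometry.ConformalRectangle.crossRatio_eq_of_isUniformizing_holds
[support] Rectangles are conformal rectangles and their modulus is a continuous function of the
aspect ratio onto (0,1): (a) for all w, h > 0 some R : ConformalRectangle has carrier (0,w)×(0,h)
and corner marks ih, 0, w, w+ih (polygonDomain of PolygonalDomains.lean); (b) there is g : ℝ → ℝ,
continuous on (0,∞) with g''(0,∞) = (0,1), such that every uniformizing datum (φ, x) of every such R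
has crossRatio x = g(w/h) (classically g via the elliptic modulus: Schwarz–Christoffel for the
rectangle, Ahlfors Ch. 6; datum-independence is crossRatio_eq_of_isUniformizing_holds). Pure complex
analysis. [difficulty: L] -/
@[route_item "route-CriticalPhenomena-CardyMonotoneApproach", crux]
def RectModulus : Prop :=
  (∀ w h : ℝ, 0 < w → 0 < h → ∃ R : Literature.Probability.RandomPlanarGeometry.ConformalRectangle, R.carrier = Set.Ioo (0:ℝ) w ×ℂ Set.Ioo (0:ℝ) h ∧ (R.pt 0 = (h:ℂ) * Complex.I ∧ R.pt 1 = 0 ∧ R.pt 2 = (w:ℂ) ∧ R.pt 3 = (w:ℂ) + (h:ℂ) * Complex.I)) ∧ ∃ g : ℝ → ℝ, ContinuousOn g (Set.Ioi 0) ∧ g '' Set.Ioi 0 = Set.Ioo 0 1 ∧ ∀ (R : Literature.Probability.RandomPlanarGeometry.ConformalRectangle) (w h : ℝ), 0 < w → 0 < h → R.carrier = Set.Ioo (0:ℝ) w ×ℂ Set.Ioo (0:ℝ) h → (R.pt 0 = (h:ℂ) * Complex.I ∧ R.pt 1 = 0 ∧ R.pt 2 = (w:ℂ) ∧ R.pt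 3 = (w:ℂ) + (h:ℂ) * Complex.I) → ∀ (φ : Literature.Probability.RandomPlanarGeometry.ConformalEquiv UpperHalfPlane.upperHalfPlaneSet R.carrier) (x : Fin 4 → ℝ), R.IsUniformizing φ x → Literature.Probability.RandomPlanarGeometry.crossRatio x = g (w / h)

/-- item stmt-CriticalPhenomena-5848 · support · rank 9 · open · by planner
sources: Ahlfors1979, lean:Literature.Probability.RandomPlanarGeometry.MarkedDomain.exists_isUniformizing_holds
[support] Every η ∈ (0,1) is the cross-ratio of a uniformizing datum of some axis-parallel rectangle
with corner marks (w, h > 0). Immediate from RectModulus and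
MarkedDomain.exists_isUniformizing_holds (proved in the planner sketch:
rectRealises_of_rectModulus); it is the hypothesis the Assembly consumes. [difficulty: provable-now] -/
@[route_item "route-CriticalPhenomena-CardyMonotoneApproach", crux]
def RectRealises : Prop :=
  ∀ η ∈ Set.Ioo (0:ℝ) 1, ∃ (R : Literature.Probability.RandomPlanarGeometry.ConformalRectangle) (w h : ℝ) (φ : Literature.Probability.RandomPlanarGeometry.ConformalEquiv UpperHalfPlane.upperHalfPlaneSet R.carrier) (x : Fin 4 → ℝ), 0 < w ∧ 0 < h ∧ R.carrier = Set.Ioo (0:ℝ) w ×ℂ Set.Ioo (0:ℝ) h ∧ (R.pt 0 = (h:ℂ) * Complex.I ∧ R.pt 1 = 0 ∧ R.pt 2 = (w:ℂ) ∧ R.pt 3 = (w:ℂ) + (h:ℂ) * Complex.I) ∧ R.IsUniformizing φ x ∧ Literature.Probability.RandomPlanarGeometry.crossRatio x = η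

/-- item stmt-CriticalPhenomena-14174 · support · rank 10 · open · by planner
[support] By-name glue making the target reachable from the cruxes (route-choice repair 2026-08-16,
option (a) of the target-unreachable hold): RectGlue → RectModulus → MonotoneApproach → RectValue →
RectCardy. RectGlue (stmt-CriticalPhenomena-5846) is exactly this implication with the four decls
inlined symbol for symbol (refuter review dd089cd6), so the item is `id` after unfolding — provable
now in one line (`fun hRG hRM hM hRV => hRG hRM hM hRV`, planner Sketch.lean rc 0, axioms
propext/Classical.choice/Quot.sound). It records in the item graph that the cruxes MonotoneApproach
(rank 2) and RectValue (rank 3), with the supports RectGlue and RectModulus, close the target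
RectCardy; the deciding theorem threads through it. Rank 10 only so that it renders after the rank-9
supports it names. [difficulty: provable-now] Sources:
lean:Summit.CriticalPhenomena.CardyFormulaZ2.Theses.CardyMonotoneApproach.RectGlue,
lean:Summit.CriticalPhenomena.CardyFormulaZ2.Theses.CardyMonotoneApproach.RectCardy,
GrimmettPercolation1999, BollobasRiordan2006 -/
@[route_item "route-CriticalPhenomena-CardyMonotoneApproach", crux]
def RectCardyOfGlue : Prop :=
  RectGlue → RectModulus → MonotoneApproach → RectValue → RectCardy

/-- item stmt-CriticalPhenomena-5849 · assembly · rank 1 · open · by planner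
sources: Smirnov2001, Cardy1992
[assembly] RectCardy → ConfInvTransport → RectRealises → CardyFormulaZ2. -/
@[route_item "route-CriticalPhenomena-CardyMonotoneApproach"]
def Assembly : Prop :=
  (∀ (R : Literature.Probability.RandomPlanarGeometry.ConformalRectangle) (w h : ℝ), 0 < w → 0 < h → R.carrier = Set.Ioo (0:ℝ) w ×ℂ Set.Ioo (0:ℝ) h → (R.pt 0 = (h:ℂ) * Complex.I ∧ R.pt 1 = 0 ∧ R.pt 2 = (w:ℂ) ∧ R.pt 3 = (w:ℂ) + (h:ℂ) * Complex.I) → R.HasCrossingLimit (Literature.Probability.Percolation.bondDomainCrossingProb R) Literature.Probability.RandomPlanarGeometry.cardyFunction) → (∀ (R R' : Literature.Probability.RandomPlanarGeometry.ConformalRectangle) (φ : Literature.Probability.RandomPlanarGeometry.ConformalEquiv UpperHalfPlane.upperHalfPlaneSet R.carrier) (x : Fin 4 → ℝ) (φ' : Literature.Probability.RandomPlanarGeometry.ConformalEquiv UpperHalfPlane.upperHalfPlaneSet R'.carrier) (x' : Fin 4 → ℝ), R.IsUniformizing φ x → R'.IsUniformizing φ' x' → Literature.Probability.RandomPlanarGeometry.crossRatio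 x = Literature.Probability.RandomPlanarGeometry.crossRatio x' → ∀ L : ℝ, Filter.Tendsto (Literature.Probability.Percolation.bondDomainCrossingProb R) (nhdsWithin 0 (Set.Ioi 0)) (nhds L) → Filter.Tendsto (Literature.Probability.Percolation.bondDomainCrossingProb R') (nhdsWithin 0 (Set.Ioi 0)) (nhds L)) → (∀ η ∈ Set.Ioo (0:ℝ) 1, ∃ (R : Literature.Probability.RandomPlanarGeometry.ConformalRectangle) (w h : ℝ) (φ : Literature.Probability.RandomPlanarGeometry.ConformalEquiv UpperHalfPlane.upperHalfPlaneSet R.carrier) (x : Fin 4 → ℝ), 0 < w ∧ 0 < h ∧ R.carrier = Set.Ioo (0:ℝ) w ×ℂ Set.Ioo (0:ℝ) h ∧ (R.pt 0 = (h:ℂ) * Complex.I ∧ R.pt 1 = 0 ∧ R.pt 2 = (w:ℂ) ∧ R.pt 3 = (w:ℂ) + (h:ℂ) * Complex.I) ∧ R.IsUniformizing φ x ∧ Literature.Probability.RandomPlanarGeometry.crossRatio x = η) → CardyFormulaZ2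

/-! D-0027 §2.1 — DECIDING THEOREM (planner-authored via `route open/edit --closes-file`; by planner-rchoice-CriticalPhenomena-CardyMonoton-23c73db1-0 2026-08-16T03:24:25Z):
its hypotheses are this route's items and its conclusion the sub-problem Statement (glue_lint), and it elaborates with this file. -/

@[closes "route-CriticalPhenomena-CardyMonotoneApproach"] theorem closes (hM : MonotoneApproach) (hRV : RectValue) (hCIT : ConfInvTransport) (hRG : RectGlue)
    (hRM : RectModulus) (hRR : RectRealises) (hG : RectCardyOfGlue) : _root_.CardyFormulaZ2 := by
  -- D-0027 §2.1 deciding theorem (route-choice repair 2026-08-16): the cruxes MonotoneApproach (r2), RectValue (r3),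
  -- ConfInvTransport (r4) and the supports RectGlue / RectModulus / RectRealises / RectCardyOfGlue ⊢ the conjunct.
  -- Step 1: the target X = RectCardy (Cardy on axis-parallel rectangles) from the cruxes through the by-name glue.
  have hRC : RectCardy := hG hRG hRM hM hRV
  -- Step 2: transport. Given a conformal rectangle R' with uniformizing datum (φ', x'), η' := crossRatio x' ∈ (0,1);
  -- realise η' by an axis-parallel rectangle R with datum (φ, x) (RectRealises).
  intro R' φ' x' h'
  obtain ⟨R, w, h, φ, x, hw, hh, hcar, hpts, hφ, hη⟩ :=
    hRR (Literature.Probability.RandomPlanarGeometry.crossRatio x')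
      (Literature.Probability.RandomPlanarGeometry.ConformalRectangle.crossRatio_mem_Ioo_of_isUniformizing h')
  -- Cardy on the rectangle R for the datum (φ, x)
  have hlim : Filter.Tendsto (Literature.Probability.Percolation.bondDomainCrossingProb R)
      (nhdsWithin 0 (Set.Ioi 0))
      (nhds (Literature.Probability.RandomPlanarGeometry.cardyFunction
        (Literature.Probability.RandomPlanarGeometry.crossRatio x))) :=
    hRC R w h hw hh hcar hpts φ x hφ
  -- move the limit to R' (equal cross-ratios, ConfInvTransport) and rewrite crossRatio x = crossRatio x'
  have hlim' := hCIT R R' φ x φ' x' hφ h' hη _ hlim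
  rw [hη] at hlim'
  exact hlim'

end Summit.CriticalPhenomena.CardyFormulaZ2.Theses.CardyMonotoneApproach
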